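import Mathlib
import HarnessLib
import Summits.RiemannHypothesis.RiemannHypothesis.Theorems.IntegerScrewSmoothSectorDefs
import Summits.RiemannHypothesis.RiemannHypothesis.Theorems.ScrewLemmaKCoprofileDefs
import Summits.RiemannHypothesis.RiemannHypothesis.Theorems.ScrewLemmaKCoprofileCalculus

/-!
# Route `ScrewLemmaKCoprofile` — the co-profile is SQUARE-INTEGRABLE on `(0,1)` (K2 (i),
# stmt-RiemannHypothesis-21613)

`Φ_g(t) = Σ_{n ≤ 1/t} g′(nt)/n` is measurable (a countable gluing of finite sums), and when
`|g′| ≤ B` on `(0,1]` it obeys the harmonic-logarithmic bound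
`|Φ_g(t)| ≤ B·H_{⌊1/t⌋} ≤ B(1 + log(1/t)) ≤ 5B·t^{−1/4}` on `(0,1)`
(Mathlib `harmonic_le_one_add_log`, `Real.log_le_rpow_div`), so `Φ_g² ≤ 25B²·t^{−1/2}` is
dominated by an integrable function: `Φ_g ∈ L²(0,1)` for every generator that is `C¹` on `[0,1]`.

Main results: `measurable_latticeCoprofile`, `abs_latticeCoprofile_le`,
`memLp_two_latticeCoprofile`.  Mathlib only.  RH-free; nothing here bears on the truth of RH.
-/

noncomputable section

set_option linter.dupNamespace false

namespace Summit.RiemannHypothesis.RiemannHypothesis.Theorems.ScrewLemmaKCoprofile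

open MeasureTheory Set Filter

/-- `Φ_g` is measurable: `Φ_g(t) = P(t, ⌊1/t⌋₊)` with `P(t, N) = Σ_{n=1}^N g′(nt)/n` measurable in
`t` for each `N` (Mathlib's `deriv g` is measurable for every `g`) and `ℕ` countable. [folklore] -/
theorem measurable_latticeCoprofile (g : ℝ → ℝ) : Measurable (latticeCoprofile g) := by
  have hP : Measurable fun p : ℝ × ℕ => ∑ n ∈ Finset.Icc 1 p.2, deriv g (n * p.1) / n :=
    measurable_from_prod_countable_left fun N => by
      show Measurable fun x : ℝ => ∑ n ∈ Finset.Icc 1 N, deriv g (n * x) / n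
      refine Finset.measurable_sum _ fun n _ => ?_
      exact ((measurable_deriv g).comp (measurable_const.mul measurable_id)).div_const _
  have hN : Measurable fun t : ℝ => ⌊1 / t⌋₊ :=
    Nat.measurable_floor.comp (measurable_const.div measurable_id)
  exact hP.comp (measurable_id.prodMk hN)

/-- The harmonic sum over `Icc 1 N` is at most `1 + log N` (`N ≥ 1`; Mathlib's
`harmonic_le_one_add_log` in real form). [folklore] -/
theorem sum_Icc_inv_le_one_add_log {N : ℕ} (hN : 1 ≤ N) :
    ∑ n ∈ Finset.Icc 1 N, (1 : ℝ) / n ≤ 1 + Real.log N := by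
  have h := harmonic_le_one_add_log N
  have e : (harmonic N : ℝ) = ∑ n ∈ Finset.Icc 1 N, (1 : ℝ) / n := by
    rw [harmonic_eq_sum_Icc]
    push_cast
    refine Finset.sum_congr rfl fun b _ => ?_
    rw [one_div]
  have _ := hN
  rw [e] at h
  exact h

/-- Harmonic–logarithmic bound: if `|g′| ≤ B` on `(0,1]` (`B ≥ 0`) then
`|Φ_g(t)| ≤ B(1 + log(1/t))` for `t ∈ (0,1)`. [folklore] -/
theorem abs_latticeCoprofile_le {g : ℝ → ℝ} {B : ℝ} (hB0 : 0 ≤ B)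
    (hB : ∀ u ∈ Set.Ioc (0:ℝ) 1, |deriv g u| ≤ B) {t : ℝ} (ht : t ∈ Set.Ioo (0:ℝ) 1) :
    |latticeCoprofile g t| ≤ B * (1 + Real.log (1 / t)) := by
  unfold latticeCoprofile
  have ht0 : 0 < t := ht.1
  have h1t : 1 ≤ 1 / t := by rw [le_div_iff₀ ht0]; linarith [ht.2]
  have hN1 : 1 ≤ ⌊1 / t⌋₊ := (Nat.one_le_floor_iff _).mpr h1t
  have hNpos : (0:ℝ) < (⌊1 / t⌋₊ : ℝ) := by exact_mod_cast hN1
  have hNle : (⌊1 / t⌋₊ : ℝ) ≤ 1 / t := Nat.floor_le (by positivity)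
  calc |∑ n ∈ Finset.Icc 1 ⌊1 / t⌋₊, deriv g (n * t) / n|
      ≤ ∑ n ∈ Finset.Icc 1 ⌊1 / t⌋₊, |deriv g (n * t) / n| := Finset.abs_sum_le_sum_abs _ _
    _ ≤ ∑ n ∈ Finset.Icc 1 ⌊1 / t⌋₊, B * ((1 : ℝ) / n) := by
        refine Finset.sum_le_sum fun n hn => ?_
        rw [Finset.mem_Icc] at hn
        have hn1 : (1:ℝ) ≤ n := by exact_mod_cast hn.1
        have hnpos : (0:ℝ) < n := by linarith
        have hnt : (n : ℝ) * t ∈ Set.Ioc (0:ℝ) 1 := by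
          refine ⟨by positivity, ?_⟩
          have h3 : (n : ℝ) ≤ 1 / t := le_trans (by exact_mod_cast hn.2) hNle
          calc (n : ℝ) * t ≤ (1 / t) * t := mul_le_mul_of_nonneg_right h3 ht0.le
            _ = 1 := by field_simp
        rw [abs_div, abs_of_pos hnpos, div_eq_mul_one_div]
        exact mul_le_mul_of_nonneg_right (hB _ hnt) (by positivity)
    _ = B * ∑ n ∈ Finset.Icc 1 ⌊1 / t⌋₊, (1 : ℝ) / n := by rw [Finset.mul_sum]
    _ ≤ B * (1 + Real.log (⌊1 / t⌋₊ : ℝ)) :=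
        mul_le_mul_of_nonneg_left (sum_Icc_inv_le_one_add_log hN1) hB0
    _ ≤ B * (1 + Real.log (1 / t)) :=
        mul_le_mul_of_nonneg_left (by linarith [Real.log_le_log hNpos hNle]) hB0

/-- `1 + log(1/t) ≤ 5 t^{−1/4}` on `(0,1)` (`log x ≤ 4 x^{1/4}`, `1 ≤ t^{−1/4}`). [folklore] -/
theorem one_add_log_inv_le_rpow {t : ℝ} (ht : t ∈ Set.Ioo (0:ℝ) 1) :
    1 + Real.log (1 / t) ≤ 5 * t ^ (-(1 / 4 : ℝ)) := by
  have ht0 : 0 < t := ht.1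
  have h1 : Real.log (1 / t) ≤ (1 / t) ^ (1 / 4 : ℝ) / (1 / 4) :=
    Real.log_le_rpow_div (by positivity) (by norm_num)
  have h2 : (1 / t) ^ (1 / 4 : ℝ) = t ^ (-(1 / 4 : ℝ)) := by
    rw [one_div, Real.inv_rpow ht0.le, Real.rpow_neg ht0.le]
  have h3 : 1 ≤ t ^ (-(1 / 4 : ℝ)) :=
    Real.one_le_rpow_of_pos_of_le_one_of_nonpos ht0 ht.2.le (by norm_num)
  rw [h2] at h1
  linarith

/-- **K2 (i): `Φ_g ∈ L²(0,1)`** for every `g` that is `C¹` on `[0,1]` (domination by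
`25B²·t^{−1/2}`). [folklore] -/
theorem memLp_two_latticeCoprofile {g : ℝ → ℝ} (hg : ContDiffOn ℝ 1 g (Set.Icc 0 1)) :
    MemLp (latticeCoprofile g) 2 (volume.restrict (Set.Ioo (0:ℝ) 1)) := by
  obtain ⟨B, hB0, hB⟩ := exists_bound_deriv_Ioc hg
  rw [memLp_two_iff_integrable_sq (measurable_latticeCoprofile g).aestronglyMeasurable]
  have hdom : IntegrableOn (fun t : ℝ => (5 * B) ^ 2 * t ^ (-(1 / 2 : ℝ))) (Set.Ioo 0 1) := by
    have h := (intervalIntegral.intervalIntegrable_rpow' (a := 0) (b := 1) (r := -(1 / 2 : ℝ))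
      (by norm_num))
    rw [intervalIntegrable_iff_integrableOn_Ioo_of_le zero_le_one] at h
    exact h.const_mul _
  refine hdom.mono' ((measurable_latticeCoprofile g).pow_const 2).aestronglyMeasurable ?_
  refine (ae_restrict_mem measurableSet_Ioo).mono fun t ht => ?_
  have ht0 : 0 < t := ht.1
  have hΦ : |latticeCoprofile g t| ≤ B * (5 * t ^ (-(1 / 4 : ℝ))) :=
    (abs_latticeCoprofile_le hB0 hB ht).trans
      (mul_le_mul_of_nonneg_left (one_add_log_inv_le_rpow ht) hB0)
  have hsq : (t ^ (-(1 / 4 : ℝ))) ^ 2 = t ^ (-(1 / 2 : ℝ)) := by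
    rw [sq, ← Real.rpow_add ht0]; norm_num
  have hnn : 0 ≤ B * (5 * t ^ (-(1 / 4 : ℝ))) := by positivity
  rw [Real.norm_eq_abs, abs_pow]
  calc |latticeCoprofile g t| ^ 2 ≤ (B * (5 * t ^ (-(1 / 4 : ℝ)))) ^ 2 :=
        pow_le_pow_left₀ (abs_nonneg _) hΦ 2
    _ = (5 * B) ^ 2 * (t ^ (-(1 / 4 : ℝ))) ^ 2 := by ring
    _ = (5 * B) ^ 2 * t ^ (-(1 / 2 : ℝ)) := by rw [hsq]

end Summit.RiemannHypothesis.RiemannHypothesis.Theorems.ScrewLemmaKCoprofile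

end
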